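import Literature.MathematicalPhysics.QuantumLattice.KomaPiFluxCoulombGaussianDomination
import Literature.MathematicalPhysics.QuantumLattice.KomaPiFluxThermalTwoPointBound
import HarnessLib

/-!
# Koma 2022 with the Coulomb repulsion: the infrared bound (6.4)/(6.9) and the thermal two-point bound
# (6.16) for `H(κ, U; g, g', h; B)`

T. Koma, *Nambu–Goldstone modes for superconducting lattice fermions*, arXiv:2201.13135 (2022)
[Koma2022], §6 and §8: with the Gaussian domination (8.4) for the model with the nearest-neighbour
Coulomb repulsion `g'Σ_{bonds}Γ³_xΓ³_y` (`KomaPiFluxCoulombGaussianDomination.partitionFn_le_coulomb`), the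
infrared bound (6.4) for the Duhamel two-point function of the pair field operator, its momentum-space
form (6.9), and the Falk–Bruch transfer (6.16) go through verbatim ("When `g'/g` is small, the
corresponding contribution by this new interaction which appears in the double commutator in `c_p` is
small. Therefore, the long-range order still exists", p. 33). This file is the `g' ≥ 0` edition of
`KomaPiFluxInfraredBound.lean` and `KomaPiFluxThermalTwoPointBound.lean`:

* `PairHopRP.hamiltonianC_field` — `H(t·h) = H(0) + t·V_h + ½t²Q_h` with the Coulomb term;
* `duhamel_fieldOp_le_coulomb` ((6.4)), `duhamel_modes_le_coulomb` ((6.9): `(C_p,C_p) + (S_p,S_p) ≤ |Λ|/(βgE_p)`);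
* `gibbs_modes_le_coulomb` ((6.16)): `⟨C_p²⟩ + ⟨S_p²⟩ ≤ b₀ + ½√(βb₀(c(C_p) + c(S_p)))`, `b₀ = |Λ|/(βgE_p)`,
  the double commutators now taken with `H(κ,U;g,g',0;B)`; `doubleComm_nonneg_coulomb`.

No named fact.

## References

* [Koma2022] T. Koma, arXiv:2201.13135, (6.2)–(6.16), §8 (8.4), p. 33.
* [DLS1978] F. J. Dyson, E. H. Lieb, B. Simon, J. Stat. Phys. 18 (1978) 335, eq. (44), Thms. 3.1–3.2.
-/

noncomputable section

namespace Literature.MathematicalPhysics.QuantumLattice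

open Matrix Finset HubbardWave0 NormedSpace PairHopRP LiebCutRP PairHopCutRP
open Literature.Probability.LatticeModels

namespace PairHopRP

variable {Λ : Type*} [LinearOrder Λ] [Fintype Λ] (G : SimpleGraph Λ) [DecidableRel G.Adj]

/-- `H(t·h) = H(0) + t·V_h + ½t²·Q_h` with the Coulomb term (which carries no field). [cite: Koma2022, (6.6)–(6.7), (8.3)] -/
theorem hamiltonianC_field (T : Fin 2 → Λ → Λ → ℂ) (U g g' : ℝ) (h : Λ → Λ → ℝ) (t B : ℝ) :
    hamiltonianC G T U g g' (fun x y => t * h x y) B =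
      hamiltonianC G T U g g' (fun _ _ => 0) B + (t : ℂ) • fieldOp G g h +
        ((t ^ 2 * fieldEnergy G g h / 2 : ℝ) : ℂ) • (1 : Matrix (Finset (Orb Λ)) (Finset (Orb Λ)) ℂ) := by
  rw [hamiltonianC, hamiltonianC, hamiltonian_field]
  abel

end PairHopRP

namespace KomaPiFlux

attribute [local instance] LiebCutRP.decEqTorus

variable {d L : ℕ} [NeZero L]

/-- **(6.4) with the Coulomb term**: `Re (V_h, V_h) ≤ Q_h/β` in the Gibbs state of `H(κ,U;g,g',0;B)`
(`κ, g, g' ≥ 0`, `β > 0`). [cite: Koma2022, (6.2)–(6.7), §8 (8.4)] [cite: DLS1978, eq. (44)] -/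
theorem duhamel_fieldOp_le_coulomb (hL : Even L) (h4 : 4 ≤ L) {β : ℝ} (hβ : 0 < β) {κ : ℝ} (hκ : 0 ≤ κ)
    (U : ℝ) {g : ℝ} (hg : 0 ≤ g) {g' : ℝ} (hg' : 0 ≤ g') (h : FermionTorus (d + 1) L → FermionTorus (d + 1) L → ℝ)
    (B : ℝ) :
    (duhamel β (hamiltonianC κ U g g' (fun (_ _ : FermionTorus (d + 1) L) => (0 : ℝ)) B)
        (fieldOp (G d L) g h) (fieldOp (G d L) g h)).re ≤ fieldEnergy (G d L) g h / β := by
  haveI : Nonempty (Finset (Orb (FermionTorus (d + 1) L))) := ⟨∅⟩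
  refine gaussianDomination_duhamel_le_holds _ β hβ _ _ (hamiltonianC_isHermitian κ U g g' _ B)
    (fieldOp_isHermitian (G d L) g h) _ (fun t => ?_)
  have key := partitionFn_le_coulomb hL h4 hβ hκ U hg hg' (fun x y => (-t) * h x y) B
  rw [hamiltonianC, PairHopRP.hamiltonianC_field, Complex.ofReal_neg, neg_smul, ← sub_eq_add_neg,
    neg_sq] at key
  exact key

/-- `(aA, aB) = a² (A, B)` (plumbing). [cite: DLS1978, eq. (5)] -/
private theorem duhamel_smul_smul'' {n : Type*} [Fintype n] [DecidableEq n] (β : ℝ)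
    (H A B : Matrix n n ℂ) (a : ℂ) : duhamel β H (a • A) (a • B) = a * a * duhamel β H A B := by
  unfold duhamel
  rw [mul_left_comm, ← smul_eq_mul (a * a), ← intervalIntegral.integral_smul]
  congr 1
  refine intervalIntegral.integral_congr fun s _ => ?_
  simp only [Matrix.smul_mul, Matrix.mul_smul, trace_smul, smul_eq_mul]
  ring

/-- **(6.9) with the Coulomb term**: `Re (C_p, C_p) + Re (S_p, S_p) ≤ |Λ|/(βgE_p)` in the Gibbs state of
`H(κ,U;g,g',0;B)` (`κ, g' ≥ 0`, `g > 0`, `β > 0`, `E_p > 0`). [cite: Koma2022, (6.8)–(6.10), §8] [cite: DLS1978, eq. (44)] -/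
theorem duhamel_modes_le_coulomb (hL : Even L) (h4 : 4 ≤ L) {β : ℝ} (hβ : 0 < β) {κ : ℝ} (hκ : 0 ≤ κ)
    (U : ℝ) {g : ℝ} (hg : 0 < g) {g' : ℝ} (hg' : 0 ≤ g') (B : ℝ) {p : TorusSite (d + 1) L}
    (hp : 0 < dispersion (latticeMomentum L p)) :
    (duhamel β (hamiltonianC κ U g g' (fun (_ _ : FermionTorus (d + 1) L) => (0 : ℝ)) B)
        (gammaOneMode (cosWave p)) (gammaOneMode (cosWave p))).re +
      (duhamel β (hamiltonianC κ U g g' (fun (_ _ : FermionTorus (d + 1) L) => (0 : ℝ)) B)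
        (gammaOneMode (sinWave p)) (gammaOneMode (sinWave p))).re ≤
      (L : ℝ) ^ (d + 1) / (β * g * dispersion (latticeMomentum L p)) := by
  have h3 : 3 ≤ L := by omega
  set E := dispersion (latticeMomentum L p) with hE
  set H₀ := hamiltonianC κ U g g' (fun (_ _ : FermionTorus (d + 1) L) => (0 : ℝ)) B with hH₀
  have hc := duhamel_fieldOp_le_coulomb hL h4 hβ hκ U hg.le hg' (waveField (cosWave p)) B
  have hs := duhamel_fieldOp_le_coulomb hL h4 hβ hκ U hg.le hg' (waveField (sinWave p)) B
  rw [fieldOp_cosWave h3, duhamel_smul_smul'', ← Complex.ofReal_mul, Complex.re_ofReal_mul] at hc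
  rw [fieldOp_sinWave h3, duhamel_smul_smul'', ← Complex.ofReal_mul, Complex.re_ofReal_mul] at hs
  have hQ := fieldEnergy_cosWave_add_sinWave h3 g p
  have hgE : 0 < g * E := mul_pos hg hp
  have hsum : (g * E) ^ 2 * ((duhamel β H₀ (gammaOneMode (cosWave p)) (gammaOneMode (cosWave p))).re +
      (duhamel β H₀ (gammaOneMode (sinWave p)) (gammaOneMode (sinWave p))).re) ≤
      g * E * (L : ℝ) ^ (d + 1) / β := by
    have : (-(g * E)) * (-(g * E)) = (g * E) ^ 2 := by ring
    rw [this] at hc hs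
    rw [← hQ, add_div]
    linarith
  rw [le_div_iff₀ (by positivity)]
  have h2 : (g * E) ^ 2 * (((duhamel β H₀ (gammaOneMode (cosWave p)) (gammaOneMode (cosWave p))).re +
      (duhamel β H₀ (gammaOneMode (sinWave p)) (gammaOneMode (sinWave p))).re) * (β * g * E)) ≤
      (g * E) ^ 2 * (L : ℝ) ^ (d + 1) := by
    calc (g * E) ^ 2 * (((duhamel β H₀ (gammaOneMode (cosWave p)) (gammaOneMode (cosWave p))).re +
          (duhamel β H₀ (gammaOneMode (sinWave p)) (gammaOneMode (sinWave p))).re) * (β * g * E))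
        = ((g * E) ^ 2 * ((duhamel β H₀ (gammaOneMode (cosWave p)) (gammaOneMode (cosWave p))).re +
            (duhamel β H₀ (gammaOneMode (sinWave p)) (gammaOneMode (sinWave p))).re)) * (β * g * E) := by
          ring
      _ ≤ (g * E * (L : ℝ) ^ (d + 1) / β) * (β * g * E) :=
          mul_le_mul_of_nonneg_right hsum (by positivity)
      _ = (g * E) ^ 2 * (L : ℝ) ^ (d + 1) := by field_simp
  exact le_of_mul_le_mul_left h2 (by positivity)

/-- **(6.16) with the Coulomb term**: `⟨C_p²⟩ + ⟨S_p²⟩ ≤ b₀ + ½√(βb₀(c(C_p) + c(S_p)))`, `b₀ = |Λ|/(βgE_p)`,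
in the Gibbs state of `H(κ,U;g,g',0;B)`, the double commutators taken with that Hamiltonian.
[cite: Koma2022, (6.13)–(6.16), §8] [cite: DLS1978, Thms. 3.1–3.2] -/
theorem gibbs_modes_le_coulomb (hL : Even L) (h4 : 4 ≤ L) {β : ℝ} (hβ : 0 < β) {κ : ℝ} (hκ : 0 ≤ κ) (U : ℝ)
    {g : ℝ} (hg : 0 < g) {g' : ℝ} (hg' : 0 ≤ g') (B : ℝ) {p : TorusSite (d + 1) L}
    (hp : 0 < dispersion (latticeMomentum L p)) :
    (gibbsState β (hamiltonianC κ U g g' (fun (_ _ : FermionTorus (d + 1) L) => (0 : ℝ)) B)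
        (gammaOneMode (cosWave p) * gammaOneMode (cosWave p))).re +
      (gibbsState β (hamiltonianC κ U g g' (fun (_ _ : FermionTorus (d + 1) L) => (0 : ℝ)) B)
        (gammaOneMode (sinWave p) * gammaOneMode (sinWave p))).re ≤
      (L : ℝ) ^ (d + 1) / (β * g * dispersion (latticeMomentum L p)) +
        1 / 2 * Real.sqrt (β * ((L : ℝ) ^ (d + 1) / (β * g * dispersion (latticeMomentum L p))) *
          (doubleComm β (hamiltonianC κ U g g' (fun (_ _ : FermionTorus (d + 1) L) => (0 : ℝ)) B)
              (gammaOneMode (cosWave p)) +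
            doubleComm β (hamiltonianC κ U g g' (fun (_ _ : FermionTorus (d + 1) L) => (0 : ℝ)) B)
              (gammaOneMode (sinWave p)))) := by
  set H₀ := hamiltonianC κ U g g' (fun (_ _ : FermionTorus (d + 1) L) => (0 : ℝ)) B with hH₀
  have hH : H₀.IsHermitian := hamiltonianC_isHermitian κ U g g' _ B
  have hA : ∀ k : Fin 2, (![gammaOneMode (cosWave p), gammaOneMode (sinWave p)] k).IsHermitian := by
    intro k
    fin_cases k
    · exact gammaOneMode_isHermitian _
    · exact gammaOneMode_isHermitian _
  have hb : ∑ k : Fin 2, (duhamel β H₀ (![gammaOneMode (cosWave p), gammaOneMode (sinWave p)] k)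
      (![gammaOneMode (cosWave p), gammaOneMode (sinWave p)] k)).re ≤
      (L : ℝ) ^ (d + 1) / (β * g * dispersion (latticeMomentum L p)) := by
    rw [Fin.sum_univ_two]
    exact duhamel_modes_le_coulomb hL h4 hβ hκ U hg hg' B hp
  have h := falkBruch_sum_le_of_le hH hβ.le hA hb
  simp only [Fin.sum_univ_two, Matrix.cons_val_zero, Matrix.cons_val_one] at h
  exact h

/-- The double commutators with the Coulomb Hamiltonian are nonnegative. [cite: DLS1978, Thm. 3.2] [cite: Koma2022, (6.22)] -/
theorem doubleComm_nonneg_coulomb {β : ℝ} (hβ : 0 ≤ β) (κ U g g' : ℝ)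
    (h : FermionTorus (d + 1) L → FermionTorus (d + 1) L → ℝ) (B : ℝ)
    {A : Matrix (Finset (Orb (FermionTorus (d + 1) L))) (Finset (Orb (FermionTorus (d + 1) L))) ℂ}
    (hA : A.IsHermitian) : 0 ≤ doubleComm β (hamiltonianC κ U g g' h B) A :=
  (hamiltonianC_isHermitian κ U g g' h B).re_gibbsState_doubleComm_nonneg hA hβ

end KomaPiFlux

end Literature.MathematicalPhysics.QuantumLattice

end
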